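import Literature.NumberTheory.EllipticCurves.IsogenyLocalPointsMaps
import Literature.NumberTheory.EllipticCurves.VariableChangePointsMap
import HarnessLib

/-!
# ErratumRoadFive ∕ EulerHalf ∕ genus line — THE TRANSPORT SIGN LEMMA `Θ_{−ϑ} = −Θ_ϑ` (helper, `--supports 23444`)

Cell bsd-stepL, seat bsd-idea-9 g26 (planner; line owner `genus` on the aside item
`stmt-BirchSwinnertonDyer-23444`, RULING 96 (ii)).  Piece F.5 (ii) of the gen-5 design memo
(`Cruxes/EulerHalfNotRamNoInertSetAtFive/Lines/genus_gen5_design.md` @e3f44af6a6bf): a CM-presented genus datum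
`δ` at level `c` carries ITS OWN square root `δ.ϑ` of `d₁` in `K[c]`, while the labelled family of bsd-addord
(`…Theorems.AdditiveBranchIMCGenusKolyvaginPointsR`) uses the pinned root `ϑ_c = χ(c)·θ`; the two transports agree up
to SIGN.  `twist_congr` (loc. cit.) is the equal-roots case; this file is the opposite-roots case: replacing `ϑ` by
`−ϑ` in the untwisting substitution `(x', y') ↦ (ϑ²x', ϑ³y')` NEGATES the transported point (the twisted model has
`a₁ = a₃ = 0`), and the outer substitution `C₂` is additive.  Together: for any two square roots `ϑ, ϑ'` of `d₁`
in a field, `Θ_{ϑ'}(Q) = Θ_ϑ(Q) ∨ Θ_{ϑ'}(Q) = −Θ_ϑ(Q)` (`genusTransport_eq_or_eq_neg`).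

HONEST FRAMING: elementary algebra of Weierstrass substitutions (Silverman AEC III.1, X.5 Cor. 5.4); nothing about
BSD, no crux and no stub is closed by this file; BSD is proved for no curve.
[cite: SilvermanAEC2009, III.1 Table 3.1; X.5 Cor. 5.4]
presearch: Θ_{−ϑ} = −Θ_ϑ → in-tree only (`untwistAt`, `pointInv_some`, `ofX_def`, `ofY_def`; no literature needed).
-/

noncomputable section

set_option autoImplicit false
set_option linter.dupNamespace false

open WeierstrassCurve
open Literature.NumberTheory.EllipticCurves

namespace Summit.BirchSwinnertonDyer.BirchSwinnertonDyer.Theorems.GenusLine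

/-- The untwisting substitution with `−ϑ` is the NEGATIVE of the one with `ϑ`:
`ι_{−ϑ}⁻¹ = − ι_ϑ⁻¹` on points of the model `V = (D • E′)_L` (`a₁ = a₃ = 0` on the twisted model, so
`(ϑ²x, −ϑ³y) = −(ϑ²x, ϑ³y)`). [cite: SilvermanAEC2009, X.5 Cor. 5.4] -/
theorem untwist_symm_neg_root (V : WeierstrassCurve ℚ) [V.IsCharNeTwoNF] (d₁ : ℤ)
    {L : Type} [Field L] [Algebra ℚ L] [DecidableEq L] {ϑ ϑ' : L}
    (hϑ2 : ϑ ^ 2 = algebraMap ℚ L (d₁ : ℚ)) (hϑ0 : ϑ ≠ 0)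
    (hϑ'2 : ϑ' ^ 2 = algebraMap ℚ L (d₁ : ℚ)) (hϑ'0 : ϑ' ≠ 0) (h : ϑ' = -ϑ)
    (R : (V.baseChange L).toAffine.Point) :
    (VariableChange.pointEquiv ((V.quadraticTwist (d₁ : ℚ)).baseChange L) (untwistAt hϑ'0)).symm
        ((Affine.Point.congrEquiv (untwistAt_smul_eq V hϑ'2 hϑ'0)).symm R) =
      - (VariableChange.pointEquiv ((V.quadraticTwist (d₁ : ℚ)).baseChange L) (untwistAt hϑ0)).symm
        ((Affine.Point.congrEquiv (untwistAt_smul_eq V hϑ2 hϑ0)).symm R) := by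
  subst h
  rcases R with _ | ⟨x, y, hxy⟩
  · rw [← Affine.Point.zero_def]; simp only [map_zero, neg_zero]
  · -- the transports along the two curve equalities are the identity on coordinates
    have hc : ∀ {θ : L} (hθ2 : θ ^ 2 = algebraMap ℚ L (d₁ : ℚ)) (hθ0 : θ ≠ 0),
        ∃ h', (Affine.Point.congrEquiv (untwistAt_smul_eq V hθ2 hθ0)).symm (.some x y hxy) = .some x y h' := by
      intro θ hθ2 hθ0
      have h' : (untwistAt hθ0 • (V.quadraticTwist (d₁ : ℚ)).baseChange L).toAffine.Nonsingular x y := by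
        rw [untwistAt_smul_eq V hθ2 hθ0]; exact hxy
      refine ⟨h', ?_⟩
      rw [AddEquiv.symm_apply_eq, Affine.Point.congrEquiv_some]
    obtain ⟨h₁, e₁⟩ := hc hϑ'2 hϑ'0
    obtain ⟨h₂, e₂⟩ := hc hϑ2 hϑ0
    rw [e₁, e₂, VariableChange.pointEquiv_symm_apply, VariableChange.pointEquiv_symm_apply,
      VariableChange.pointInv_some, VariableChange.pointInv_some, Affine.Point.neg_some]
    -- coordinates: `ofX = u² x`, `ofY = u³ y` for `u = ∓ϑ`, `r = s = t = 0`; `negY x y = -y` (a₁ = a₃ = 0)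
    simp only [Affine.Point.some.injEq]
    refine ⟨?_, ?_⟩
    · simp [VariableChange.ofX_def, untwistAt]
    · simp [VariableChange.ofY_def, untwistAt, Affine.negY, quadraticTwist_a₁, quadraticTwist_a₃]
      try ring

/-- **`Θ_{−ϑ}(Q) = −Θ_ϑ(Q)`** for the full genus transport
`Θ_ϑ = C₂ ∘ ι_ϑ⁻¹ ∘ D : E′(L) → (C₂ • (D • E′)^{(d₁)})(L)` of bsd-addord ∕ the genus line (`twist_congr` is the
case `ϑ' = ϑ`). [cite: SilvermanAEC2009, X.5 Cor. 5.4] -/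
theorem genusTransport_neg_root (E' : WeierstrassCurve ℚ) (D C₂ : VariableChange ℚ) [(D • E').IsCharNeTwoNF]
    (d₁ : ℤ) {L : Type} [Field L] [Algebra ℚ L] [DecidableEq L] {ϑ ϑ' : L}
    (hϑ2 : ϑ ^ 2 = algebraMap ℚ L (d₁ : ℚ)) (hϑ0 : ϑ ≠ 0)
    (hϑ'2 : ϑ' ^ 2 = algebraMap ℚ L (d₁ : ℚ)) (hϑ'0 : ϑ' ≠ 0) (h : ϑ' = -ϑ)
    (Q : (E'.baseChange L).toAffine.Point) :
    VariableChange.pointEquivBaseChange ((D • E').quadraticTwist (d₁ : ℚ)) C₂ L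
        ((VariableChange.pointEquiv (((D • E').quadraticTwist (d₁ : ℚ)).baseChange L) (untwistAt hϑ'0)).symm
          ((Affine.Point.congrEquiv (untwistAt_smul_eq (D • E') hϑ'2 hϑ'0)).symm
            (VariableChange.pointEquivBaseChange E' D L Q))) =
      - VariableChange.pointEquivBaseChange ((D • E').quadraticTwist (d₁ : ℚ)) C₂ L
        ((VariableChange.pointEquiv (((D • E').quadraticTwist (d₁ : ℚ)).baseChange L) (untwistAt hϑ0)).symm
          ((Affine.Point.congrEquiv (untwistAt_smul_eq (D • E') hϑ2 hϑ0)).symm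
            (VariableChange.pointEquivBaseChange E' D L Q))) := by
  rw [untwist_symm_neg_root (D • E') d₁ hϑ2 hϑ0 hϑ'2 hϑ'0 h, map_neg]

/-- Two square roots of `d₁` in a field are equal or opposite. [folklore] -/
theorem sqrt_eq_or_eq_neg {L : Type} [Field L] [Algebra ℚ L] {d₁ : ℤ} {ϑ ϑ' : L}
    (hϑ2 : ϑ ^ 2 = algebraMap ℚ L (d₁ : ℚ)) (hϑ'2 : ϑ' ^ 2 = algebraMap ℚ L (d₁ : ℚ)) :
    ϑ' = ϑ ∨ ϑ' = -ϑ := by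
  have hsq : ϑ' ^ 2 = ϑ ^ 2 := by rw [hϑ'2, hϑ2]
  exact sq_eq_sq_iff_eq_or_eq_neg.mp hsq

/-- **`Θ_{ϑ'}(Q) = ± Θ_ϑ(Q)` for ANY two square roots `ϑ, ϑ'` of `d₁`** — the sign ambiguity of the genus transport
(memo §F.5 (ii): a CM-presented datum's own root versus the pinned root of the labelled family).
[cite: SilvermanAEC2009, X.5 Cor. 5.4] -/
theorem genusTransport_eq_or_eq_neg (E' : WeierstrassCurve ℚ) (D C₂ : VariableChange ℚ) [(D • E').IsCharNeTwoNF]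
    (d₁ : ℤ) {L : Type} [Field L] [Algebra ℚ L] [DecidableEq L] {ϑ ϑ' : L}
    (hϑ2 : ϑ ^ 2 = algebraMap ℚ L (d₁ : ℚ)) (hϑ0 : ϑ ≠ 0)
    (hϑ'2 : ϑ' ^ 2 = algebraMap ℚ L (d₁ : ℚ)) (hϑ'0 : ϑ' ≠ 0)
    (Q : (E'.baseChange L).toAffine.Point) :
    VariableChange.pointEquivBaseChange ((D • E').quadraticTwist (d₁ : ℚ)) C₂ L
        ((VariableChange.pointEquiv (((D • E').quadraticTwist (d₁ : ℚ)).baseChange L) (untwistAt hϑ'0)).symm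
          ((Affine.Point.congrEquiv (untwistAt_smul_eq (D • E') hϑ'2 hϑ'0)).symm
            (VariableChange.pointEquivBaseChange E' D L Q))) =
      VariableChange.pointEquivBaseChange ((D • E').quadraticTwist (d₁ : ℚ)) C₂ L
        ((VariableChange.pointEquiv (((D • E').quadraticTwist (d₁ : ℚ)).baseChange L) (untwistAt hϑ0)).symm
          ((Affine.Point.congrEquiv (untwistAt_smul_eq (D • E') hϑ2 hϑ0)).symm
            (VariableChange.pointEquivBaseChange E' D L Q))) ∨
    VariableChange.pointEquivBaseChange ((D • E').quadraticTwist (d₁ : ℚ)) C₂ L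
        ((VariableChange.pointEquiv (((D • E').quadraticTwist (d₁ : ℚ)).baseChange L) (untwistAt hϑ'0)).symm
          ((Affine.Point.congrEquiv (untwistAt_smul_eq (D • E') hϑ'2 hϑ'0)).symm
            (VariableChange.pointEquivBaseChange E' D L Q))) =
      - VariableChange.pointEquivBaseChange ((D • E').quadraticTwist (d₁ : ℚ)) C₂ L
        ((VariableChange.pointEquiv (((D • E').quadraticTwist (d₁ : ℚ)).baseChange L) (untwistAt hϑ0)).symm
          ((Affine.Point.congrEquiv (untwistAt_smul_eq (D • E') hϑ2 hϑ0)).symm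
            (VariableChange.pointEquivBaseChange E' D L Q))) := by
  rcases sqrt_eq_or_eq_neg hϑ2 hϑ'2 with h | h
  · left; subst h; rfl
  · right; exact genusTransport_neg_root E' D C₂ d₁ hϑ2 hϑ0 hϑ'2 hϑ'0 h Q

end Summit.BirchSwinnertonDyer.BirchSwinnertonDyer.Theorems.GenusLine

end
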